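import Literature.Computability.FineGrained.Sweep1OVMainLoop
import HarnessLib

/-!
# Williams' Orthogonal Vectors algorithm on the word RAM: running time and word size

Continuation of `Literature.Computability.FineGrained.Sweep1OVMainLoop` (R. Williams, FOCS 2024 /
ECCC TR24-142, Thms. 10 and 3): the running time of `OVEq.prog` in closed form
(`Ttotal_le`: `Ttotal + 1 ≤ 15 L + 2 tsz + 9 n + 4 K + 37 + 32 · RK · (n + 1) · (K + 1)`, i.e.
`O(r^K · n · K)` plus reading the input and the constant tables), and the word size: in the regime
`d ≤ c ⌊log₂ n⌋` every power over the `K = ⌈d/k⌉` blocks is polynomial in `2^{inputWidth}`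
(`pow_K_le`: `B^K ≤ ω^{c · size B}`), so the run at word size `kfit tb c · inputWidth x` — a constant
multiple of the input width, the `Θ(log n)`-bit-word convention of `FGProblem.InTimeInst` — meets all
requirements `Fits` of the verified run (`fits`).

## References

* R. Williams, *The Orthogonal Vectors Conjecture and Non-Uniform Circuit Lower Bounds*, FOCS 2024;
  ECCC TR24-142, §3, Thm. 3 (proof: "`O((2^{ε′k})^{d/k}) ≤ O(2^{ε′d}) ≤ O(n^{ε/2})` equality
  matrices").
* V. Vassilevska Williams, *On some fine-grained questions in algorithms and complexity*,
  Proc. ICM 2018, §2 (the word RAM with `Θ(log n)`-bit words).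
-/

namespace Literature.Computability.FineGrained

open Cryptography Cryptography.WordRAM Complexity Cryptography.WordRAM.SProg

namespace OVEq

namespace Params

open Finset

variable (g : Params) {W : ℕ} {O : List ℕ → List ℕ}

/-! ### The running time in closed form -/

/-- **The running time**, bounded by the input length, the table size, `n`, `K`, and
`RK · (n + 1) · (K + 1)`. [folklore] -/
theorem Ttotal_le : g.Ttotal + 1 ≤
    15 * g.L + 2 * g.tb.tsz + 9 * g.n + 4 * g.K + 37 + 32 * (g.RK * ((g.n + 1) * (g.K + 1))) := by
  have hL := g.L_eq
  have hTq : g.Tq + 2 ≤ 32 * ((g.n + 1) * (g.K + 1)) := by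
    unfold Tq
    have e1 : g.n * (g.K * 28 + 32) = 28 * (g.n * g.K) + 32 * g.n := by ring
    have e2 : (g.n + 1) * (g.K + 1) = g.n * g.K + g.n + g.K + 1 := by ring
    omega
  have hmain : g.RK * (g.Tq + 2) ≤ 32 * (g.RK * ((g.n + 1) * (g.K + 1))) := by
    calc g.RK * (g.Tq + 2) ≤ g.RK * (32 * ((g.n + 1) * (g.K + 1))) := Nat.mul_le_mul_left _ hTq
      _ = _ := by ring
  unfold Ttotal
  have e3 : g.n * (g.d * 16 + 9) = 16 * (g.n * g.d) + 9 * g.n := by ring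
  omega


/-! ### The word size -/

/-- `m ω ≤ ω^(m+1)` for `ω ≥ 2`. [folklore] -/
theorem mul_le_pow_succ {ω : ℕ} (hω : 2 ≤ ω) (m : ℕ) : m * ω ≤ ω ^ (m + 1) := by
  rw [pow_succ]
  refine Nat.mul_le_mul_right _ ?_
  calc m ≤ 2 ^ m := Nat.lt_two_pow_self.le
    _ ≤ ω ^ m := Nat.pow_le_pow_left hω m

/-- Absorbing a sum into one power, for `ω ≥ 2`. [folklore] -/
theorem add_le_pow {ω a b i j : ℕ} (hω : 2 ≤ ω) (ha : a < ω ^ i) (hb : b ≤ ω ^ j) :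
    a + b + 1 ≤ ω ^ (i + j + 1) := by
  have h1 : ω ^ i ≤ ω ^ (i + j) := Nat.pow_le_pow_right (by omega) (by omega)
  have h2 : ω ^ j ≤ ω ^ (i + j) := Nat.pow_le_pow_right (by omega) (by omega)
  have h3 : 2 * ω ^ (i + j) ≤ ω ^ (i + j + 1) := by
    rw [pow_succ, Nat.mul_comm]; exact Nat.mul_le_mul_left _ hω
  omega

/-- **The word-size constant** of the program of tables `tb` in the regime `d ≤ c log₂ n`.
[folklore] -/
def kfit (tb : Tables) (c : ℕ) : ℕ :=
  tb.tsz + tb.k + 120 + c * (Nat.size tb.Bd + 2 * Nat.size tb.r + 3 * Nat.size tb.cmax) +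
    Nat.size (tb.Bd + tb.P + tb.cmax)

/-- Powers over the blocks are polynomial in the regime `d ≤ c log₂ n`: `B^K ≤ ω^(c · size B)`
for every `ω > 2^{⌊log₂ n⌋}` (in particular `ω = 2^{inputWidth}`). [folklore] -/
theorem pow_K_le {c ω : ℕ} (hk : 1 ≤ g.tb.k) (hd : g.d ≤ c * Nat.log 2 g.n)
    (hω : 2 ^ Nat.log 2 g.n ≤ ω) (B : ℕ) : B ^ g.K ≤ ω ^ (c * Nat.size B) := by
  have hKd := g.K_le_d hk
  rcases Nat.eq_zero_or_pos B with rfl | hB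
  · rcases Nat.eq_zero_or_pos g.K with h0 | hK
    · rw [h0, pow_zero]
      exact Nat.one_le_pow _ _ (Nat.pos_of_ne_zero (by rintro rfl; simp at hω))
    · rw [zero_pow (by omega)]; exact Nat.zero_le _
  · have hBs : B < 2 ^ Nat.size B := Nat.lt_size_self B
    calc B ^ g.K ≤ B ^ (c * Nat.log 2 g.n) := Nat.pow_le_pow_right hB (hKd.trans hd)
      _ ≤ (2 ^ Nat.size B) ^ (c * Nat.log 2 g.n) := Nat.pow_le_pow_left hBs.le _
      _ = (2 ^ Nat.log 2 g.n) ^ (c * Nat.size B) := by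
          rw [← pow_mul, ← pow_mul]; congr 1; ring
      _ ≤ ω ^ (c * Nat.size B) := Nat.pow_le_pow_left hω _

set_option maxHeartbeats 1000000 in
/-- **The word size fits.** In the regime `d ≤ c log₂ n`, the run at word size
`kfit · inputWidth x` satisfies `Fits` (tables with `k ≥ 1`). [folklore] -/
theorem fits (htb : g.tb.WF) {c : ℕ} (hd : g.d ≤ c * Nat.log 2 g.n) :
    g.Fits (kfit g.tb c * inputWidth g.x) := by
  have hk := htb.k_pos
  set w := inputWidth g.x with hw
  set ω := 2 ^ w with hω
  have hw1 : 1 ≤ w := inputWidth_pos _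
  have hω2 : 2 ≤ ω := by
    calc (2 : ℕ) = 2 ^ 1 := rfl
      _ ≤ 2 ^ w := Nat.pow_le_pow_right (by norm_num) hw1
  have hLω : g.L < ω := length_lt_two_pow_inputWidth _
  have hnω : g.n < ω := lt_two_pow_inputWidth_of_mem _ _ (by unfold x; exact List.mem_cons_self ..)
  have hdω : g.d < ω := lt_two_pow_inputWidth_of_mem _ _ (by
    unfold x OVInstance.encode; exact List.mem_cons_of_mem _ (List.mem_cons_self ..))
  have hE : 2 ^ Nat.log 2 g.n ≤ ω := by
    rcases Nat.eq_zero_or_pos g.n with h0 | hn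
    · rw [h0]; simp; omega
    · exact (Nat.pow_log_le_self 2 hn.ne').trans hnω.le
  have hKd := g.K_le_d hk
  obtain ⟨hX, hTU, hTV, hTC, hTS, hBA, hBB, hKA, hH0⟩ := g.bases
  have hL := g.L_eq
  have hBAe := g.BA_eq
  -- the exponent, with the products by `c` distributed
  set F := kfit g.tb c with hF
  set sB := Nat.size g.tb.Bd with hsB
  set sr := Nat.size g.tb.r with hsr
  set sc := Nat.size g.tb.cmax with hsc
  set sz := Nat.size (g.tb.Bd + g.tb.P + g.tb.cmax) with hsz
  have hWω : 2 ^ (F * w) = ω ^ F := by rw [hω, ← pow_mul, Nat.mul_comm]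
  have hmono : ∀ a, a ≤ F → ω ^ a ≤ ω ^ F := fun a ha => Nat.pow_le_pow_right (by omega) ha
  have hF' : F = g.tb.tsz + g.tb.k + 120 + (c * sB + 2 * (c * sr) + 3 * (c * sc)) + sz := by
    rw [hF, kfit, ← hsB, ← hsr, ← hsc, ← hsz]; ring
  -- the powers over the blocks
  have hBK : g.BK ≤ ω ^ (c * sB) := g.pow_K_le hk hd hE _
  have hRK : g.RK ≤ ω ^ (c * sr) := g.pow_K_le hk hd hE _
  have hCK : g.CK ≤ ω ^ (c * sc) := g.pow_K_le hk hd hE _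
  -- H0
  have hnK : g.n * g.K ≤ g.n * g.d := Nat.mul_le_mul_left _ hKd
  have hH0ω : g.H0 < ω ^ (g.tb.tsz + 106) := by
    have h1 : g.H0 ≤ 3 * g.L + g.n + g.tb.tsz + 101 := by unfold X at hX hTU; omega
    have h2 : g.tb.tsz ≤ g.tb.tsz * ω := Nat.le_mul_of_pos_right _ (by omega)
    have h3 : 3 * g.L + g.n + g.tb.tsz + 101 < (g.tb.tsz + 105) * ω := by
      rw [Nat.add_mul]; omega
    exact lt_of_lt_of_le (lt_of_le_of_lt h1 h3) (mul_le_pow_succ hω2 _)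
  refine ⟨?_, ?_, ?_, ?_, ?_, ?_, ?_, ?_⟩
  · -- width
    calc w = 1 * w := (Nat.one_mul _).symm
      _ ≤ F * w := Nat.mul_le_mul_right _ (by rw [hF']; omega)
  · -- top
    rw [hWω]
    exact (add_le_pow hω2 hH0ω hBK).trans (hmono _ (by rw [hF']; omega))
  · -- xx
    rw [hWω]
    have h1 : 2 * g.X + 2 < 206 * ω := by unfold X; omega
    have h2 : 206 * ω ≤ ω ^ 9 := by
      calc 206 * ω ≤ 2 ^ 8 * ω := by omega
        _ ≤ ω ^ 8 * ω := Nat.mul_le_mul_right _ (Nat.pow_le_pow_left hω2 8)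
        _ = ω ^ 9 := by ring
    exact (h1.le.trans h2).trans (hmono _ (by rw [hF']; omega))
  · -- dk
    rw [hWω]
    have h1 : g.tb.k ≤ ω ^ g.tb.k :=
      (Nat.lt_two_pow_self).le.trans (Nat.pow_le_pow_left hω2 _)
    have h2 : g.d < ω ^ 1 := by rwa [pow_one]
    have h3 := add_le_pow hω2 h2 h1
    exact (Nat.le_succ _).trans (h3.trans (hmono _ (by rw [hF']; omega)))
  · -- rk
    rw [hWω]
    have h0 : (0 : ℕ) < ω ^ 0 := by simp
    have h3 := add_le_pow hω2 h0 hRK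
    rw [Nat.zero_add] at h3
    exact h3.trans (hmono _ (by rw [hF']; omega))
  · -- bd
    rw [hWω]
    have h1 : g.tb.Bd + g.tb.P + g.tb.cmax < 2 ^ sz := Nat.lt_size_self _
    have h2 : 2 ^ sz ≤ ω ^ sz := Nat.pow_le_pow_left hω2 _
    exact (h1.le.trans h2).trans (hmono _ (by rw [hF']; omega))
  · -- prod
    rw [hWω]
    have hn2 : g.n * g.n + 1 ≤ ω ^ 2 := by
      have h : (g.n + 1) * (g.n + 1) ≤ ω * ω := Nat.mul_le_mul (by omega) (by omega)
      have e : (g.n + 1) * (g.n + 1) = g.n * g.n + 2 * g.n + 1 := by ring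
      rw [sq]; omega
    have h1 : g.RK * g.CK * (g.n * g.n + 1) ≤ ω ^ (c * sr + c * sc + 2) := by
      rw [pow_add, pow_add]
      exact Nat.mul_le_mul (Nat.mul_le_mul hRK hCK) hn2
    have h2 : g.RK * g.CK * (g.n * g.n + 1) < ω ^ (c * sr + c * sc + 3) := by
      have : ω ^ (c * sr + c * sc + 2) < ω ^ (c * sr + c * sc + 3) :=
        Nat.pow_lt_pow_right (by omega) (by omega)
      omega
    have h3 := add_le_pow hω2 h2 hCK
    exact h3.trans (hmono _ (by rw [hF']; omega))
  · -- nn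
    rw [hWω]
    have h1 : g.n * g.n + g.n + 1 ≤ ω ^ 2 := by
      have h : (g.n + 1) * (g.n + 1) ≤ ω * ω := Nat.mul_le_mul (by omega) (by omega)
      have e : (g.n + 1) * (g.n + 1) = g.n * g.n + 2 * g.n + 1 := by ring
      rw [sq]; omega
    exact h1.trans (hmono _ (by rw [hF']; omega))

end Params

end OVEq

end Literature.Computability.FineGrained
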